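import Summits.Ventures.Crystal3D.Theorems.StickyWulffConstantCoaxialWallLawBarlowPlateReadings
import Summits.Ventures.Crystal3D.Theorems.StickyWulffConstantCoaxialWallLawBarlowWindowFrames
import Summits.Ventures.Crystal3D.Theorems.StickyWulffConstantCoaxialWallLawTerracePropagation
import Summits.Ventures.Crystal3D.Theorems.StickyWulffConstantCoaxialWallLawModelNormals
import HarnessLib

/-!
# SOURCES of the F_layer word nets on a clamped Barlow plate: the `hPsrc` clause of the plate-abstract census (F_layer L2c, part 2)

HONEST FRAMING. Venture `Summits/Ventures/Crystal3D` (cell `crystal3d-full`); helper `--supports` the crux `CoaxialWallLaw`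
(stmt-Ventures-19481, REGISTERED line `WallLedgerF`) in its role as owner of lane T's debt T-F2 / F_layer (cf-p1 (lxxiii)/(lxxx)/
(lxxxiii)/(xcix); memos HOME/wall-19481-p1/g14/L2b-G3.md §1/§5, HOME/wall-19481-p1/g15/F-LAYER-SINKS-g15.md).  Census-free, standard
axioms; nothing about the crux is claimed; F-C1 not moved.

For a clamped moved Barlow plate `stacking L s σ` (configuration `X` ⊇ plate on a region `W`, `1`-separated) and a ball `p = L q + s`
whose radius-`2` ball lies in `W`, this file delivers, for BOTH bilayer frames of the plate — the plate frame `L` (tree `D₊`) and its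
basal twin `basalMirror ≫ L` (tree `D₋`) — and for every BASAL root slot `r` (`r₂ = 0`), exactly the source clause `hPsrc` of
`word_family_endPairs_plates` / `word_endPairs_multi_plates` (…PayerFamilyEndsPlates, …PayerEndPairsMultiPlates):
`p ∈ X`, an occupied `60°` face of the frame at `p`, the predecessor `p − G r ∈ X`, and the MOVING clause (FULL, or TWIN-glide along
`±L e₃`) — at every layer that is not a c-layer of the OTHER orientation:

* `isTwinReading_mirror_plateBall_up/down` — h-layers read TWIN in the mirror frame too (transport of 19481-p1 g14's
  `isTwinReading_mirror_barlowSite_*`, p689557), completing p690727's table: layer type `(σ(k−1), σ k)` = `(+,+)`: FULL in `L`;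
  `(−,−)`: FULL in `basalMirror ≫ L`; `(+,−)`, `(−,+)`: TWIN in BOTH frames (normals `±L e₃`);
* `face_of_isFull`, `face_of_isTwinReading`, `sub_mem_of_isFull`, `sub_mem_of_isTwinReading_glide` — frame-agnostic bookkeeping
  (an occupied face and the in-plane predecessor from a FULL / TWIN reading; the face of a twin reading is the far triple of `−m`);
* **`plateBall_source_frame`** (tree `D₊`, layers `≠ (−,−)`) and **`plateBall_source_mirror`** (tree `D₋`, layers `≠ (+,+)`) — the
  four-part source clause at one ball; **`hPsrc_of_plateCore_frame`** / **`hPsrc_of_plateCore_mirror`** — the clause `hPsrc` VERBATIM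
  for a finite core `P'` and an abstract admissibility predicate `srcOK`, given the invariant at the first target as a hypothesis.
WHAT THIS IS NOT: not the flux count of the sources, not the sealing, not the sinks; F-C1 not moved.
-/

noncomputable section

namespace Summit.Ventures.Crystal3D.Theorems

open Summit.Ventures.Crystal3D Finset
open Literature.MathematicalPhysics.StatisticalMechanics (barlowPos barlowStacking IsHaggSeq barlowPos_mem basalMirror
  basalMirror_apply_coord)
open Summit.Ventures.Crystal3D.Cruxes.TextureLiminf.TexShadow (E3 stacking)
open scoped InnerProductSpace

/-! ### Frame-agnostic bookkeeping: faces and predecessors from readings -/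

section Readings

variable {X : Finset E3} (G : E3 ≃ₗᵢ[ℝ] E3) {b : E3}

/-- A FULL reading has an occupied `60°` face. -/
theorem face_of_isFull (h : IsFull X G b) :
    ∃ a ∈ fccSlots, ∃ a' ∈ fccSlots, ∃ a'' ∈ fccSlots,
      ⟪a, a'⟫_ℝ = 1 / 2 ∧ ⟪a, a''⟫_ℝ = 1 / 2 ∧ ⟪a', a''⟫_ℝ = 1 / 2 ∧
      b + G a ∈ X ∧ b + G a' ∈ X ∧ b + G a'' ∈ X := by
  obtain ⟨a, ha, a', ha', a'', ha'', i1, i2, i3⟩ := exists_model_face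
  exact ⟨a, ha, a', ha', a'', ha'', i1, i2, i3, h a ha, h a' ha', h a'' ha''⟩

/-- A TWIN reading along `m` has an occupied `60°` face: the far triple of `−m` lies in the own (closed lower) half. -/
theorem face_of_isTwinReading {m : E3} (h : IsTwinReading X G m b) :
    ∃ a ∈ fccSlots, ∃ a' ∈ fccSlots, ∃ a'' ∈ fccSlots,
      ⟪a, a'⟫_ℝ = 1 / 2 ∧ ⟪a, a''⟫_ℝ = 1 / 2 ∧ ⟪a', a''⟫_ℝ = 1 / 2 ∧
      b + G a ∈ X ∧ b + G a' ∈ X ∧ b + G a'' ∈ X := by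
  obtain ⟨⟨hm, hmenu⟩, hown, -, -⟩ := h
  have hm' : ‖-m‖ = 1 := by rw [norm_neg, hm]
  have hmenu' : ∀ w ∈ fccSlots, ⟪G w, -m⟫_ℝ = 0 ∨ ⟪G w, -m⟫_ℝ = Real.sqrt (2 / 3) ∨ ⟪G w, -m⟫_ℝ = -Real.sqrt (2 / 3) := by
    intro w hw
    rcases hmenu w hw with h0 | h0 | h0
    · exact Or.inl (by rw [inner_neg_right, h0, neg_zero])
    · exact Or.inr (Or.inr (by rw [inner_neg_right, h0]))
    · exact Or.inr (Or.inl (by rw [inner_neg_right, h0, neg_neg]))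
  have hr : 0 < Real.sqrt (2 / 3) := Real.sqrt_pos.2 (by norm_num)
  obtain ⟨a, ha, a', ha', a'', ha'', hna, hna', hna'', i1, i2, i3, -, -⟩ := exists_far_frame G hm' hmenu'
  have le_of : ∀ {w : E3}, ⟪G w, -m⟫_ℝ = Real.sqrt (2 / 3) → ⟪G w, m⟫_ℝ ≤ 0 := by
    intro w hw; rw [inner_neg_right] at hw; linarith
  exact ⟨a, ha, a', ha', a'', ha'', i1, i2, i3, hown a ha (le_of hna), hown a' ha' (le_of hna'), hown a'' ha'' (le_of hna'')⟩

/-- A FULL reading contains the predecessor along any slot: `b − G r ∈ X`. -/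
theorem sub_mem_of_isFull (h : IsFull X G b) {r : E3} (hr : r ∈ fccSlots) : b - G r ∈ X := by
  have := h (-r) (neg_mem_fccSlots hr)
  rwa [map_neg, ← sub_eq_add_neg] at this

/-- A TWIN reading along `m` contains the predecessor along any slot GLIDING in the twin plane (`⟪G r, m⟫ = 0`). -/
theorem sub_mem_of_isTwinReading_glide {m : E3} (h : IsTwinReading X G m b) {r : E3} (hr : r ∈ fccSlots)
    (h0 : ⟪G r, m⟫_ℝ = 0) : b - G r ∈ X := by
  have := h.2.1 (-r) (neg_mem_fccSlots hr) (by rw [map_neg, inner_neg_left, h0, neg_zero])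
  rwa [map_neg, ← sub_eq_add_neg] at this

end Readings

/-! ### The plate: mirror-frame twin readings at h-layers, and the source clauses -/

section Plate

variable {σ : ℤ → ℤ} (hσ : IsHaggSeq σ) (L : E3 ≃ₗᵢ[ℝ] E3) (s : E3) {X : Finset E3}
  (hsep : ∀ p ∈ X, ∀ p' ∈ X, p ≠ p' → 1 ≤ dist p p') {W : Set E3}
  (hplate : ∀ p ∈ stacking L s σ, p ∈ W → p ∈ X) (k i j : ℤ)
  (hW : ∀ x, dist (L (barlowPos 1 (Real.sqrt (2 / 3)) σ k i j) + s) x ≤ 2 → x ∈ W)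

include hsep hplate hW

omit hsep in
/-- The ball itself is occupied. -/
theorem plateBall_mem : L (barlowPos 1 (Real.sqrt (2 / 3)) σ k i j) + s ∈ X :=
  hplate _ ⟨_, barlowPos_mem k i j, rfl⟩ (hW _ (by rw [dist_self]; norm_num))

include hσ

open scoped Classical in
/-- **h-layer `(+,−)` read by the MIRROR frame `basalMirror ≫ L`: TWIN with normal `−L e₃`.** -/
theorem isTwinReading_mirror_plateBall_up (h₁ : σ (k - 1) = 1) (h₂ : σ k = -1) :
    IsTwinReading X (basalMirror.trans L) (-L (EuclideanSpace.single (2 : Fin 3) (1 : ℝ)))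
      (L (barlowPos 1 (Real.sqrt (2 / 3)) σ k i j) + s) := by
  obtain ⟨hnb, hX⟩ := plateBall_model_hyps L s hsep hplate k i j hW
  have h := isTwinReading_mirror_barlowSite_up hσ k i j hX hnb h₁ h₂
  rw [← isTwinReading_transport_iff L s, pullback_image_eq, map_neg] at h
  exact h

open scoped Classical in
/-- **h-layer `(−,+)` read by the MIRROR frame `basalMirror ≫ L`: TWIN with normal `L e₃`.** -/
theorem isTwinReading_mirror_plateBall_down (h₁ : σ (k - 1) = -1) (h₂ : σ k = 1) :
    IsTwinReading X (basalMirror.trans L) (L (EuclideanSpace.single (2 : Fin 3) (1 : ℝ)))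
      (L (barlowPos 1 (Real.sqrt (2 / 3)) σ k i j) + s) := by
  obtain ⟨hnb, hX⟩ := plateBall_model_hyps L s hsep hplate k i j hW
  have h := isTwinReading_mirror_barlowSite_down hσ k i j hX hnb h₁ h₂
  rw [← isTwinReading_transport_iff L s, pullback_image_eq] at h
  exact h

open scoped Classical in
/-- **SOURCE CLAUSE, plate frame `L` (tree `D₊`)** at a ball of a layer that is not a `(−,−)` c-layer, for a basal root slot
`r`: occupied, an occupied face, the predecessor `p − L r`, and FULL or TWIN-glide along `±L e₃`. -/
theorem plateBall_source_frame (hk : ¬ (σ (k - 1) = -1 ∧ σ k = -1)) {r : E3} (hr : r ∈ fccSlots) (hr2 : r 2 = 0) :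
    L (barlowPos 1 (Real.sqrt (2 / 3)) σ k i j) + s ∈ X ∧
    (∃ a ∈ fccSlots, ∃ a' ∈ fccSlots, ∃ a'' ∈ fccSlots,
      ⟪a, a'⟫_ℝ = 1 / 2 ∧ ⟪a, a''⟫_ℝ = 1 / 2 ∧ ⟪a', a''⟫_ℝ = 1 / 2 ∧
      L (barlowPos 1 (Real.sqrt (2 / 3)) σ k i j) + s + L a ∈ X ∧
      L (barlowPos 1 (Real.sqrt (2 / 3)) σ k i j) + s + L a' ∈ X ∧
      L (barlowPos 1 (Real.sqrt (2 / 3)) σ k i j) + s + L a'' ∈ X) ∧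
    L (barlowPos 1 (Real.sqrt (2 / 3)) σ k i j) + s - L r ∈ X ∧
    (IsFull X L (L (barlowPos 1 (Real.sqrt (2 / 3)) σ k i j) + s) ∨
      ∃ m, IsTwinReading X L m (L (barlowPos 1 (Real.sqrt (2 / 3)) σ k i j) + s) ∧ ⟪L r, m⟫_ℝ = 0) := by
  have hmem := plateBall_mem L s hplate k i j hW
  have hre₃ : ⟪L r, L (EuclideanSpace.single (2 : Fin 3) (1 : ℝ))⟫_ℝ = 0 := by
    rw [LinearIsometryEquiv.inner_map_map, inner_single_two_one, hr2]
  rcases (hσ (k - 1)) with h₁ | h₁ <;> rcases (hσ k) with h₂ | h₂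
  · -- (+,+): FULL
    have hf := isFull_plateBall L s hsep hplate k i j hW h₁ h₂
    exact ⟨hmem, face_of_isFull L hf, sub_mem_of_isFull L hf hr, Or.inl hf⟩
  · -- (+,−): TWIN along `L e₃`
    have ht := isTwinReading_plateBall_up hσ L s hsep hplate k i j hW h₁ h₂
    exact ⟨hmem, face_of_isTwinReading L ht, sub_mem_of_isTwinReading_glide L ht hr hre₃, Or.inr ⟨_, ht, hre₃⟩⟩
  · -- (−,+): TWIN along `−L e₃`
    have ht := isTwinReading_plateBall_down hσ L s hsep hplate k i j hW h₁ h₂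
    have h0 : ⟪L r, -L (EuclideanSpace.single (2 : Fin 3) (1 : ℝ))⟫_ℝ = 0 := by rw [inner_neg_right, hre₃, neg_zero]
    exact ⟨hmem, face_of_isTwinReading L ht, sub_mem_of_isTwinReading_glide L ht hr h0, Or.inr ⟨_, ht, h0⟩⟩
  · exact absurd ⟨h₁, h₂⟩ hk

open scoped Classical in
/-- **SOURCE CLAUSE, mirror frame `basalMirror ≫ L` (tree `D₋`)** at a ball of a layer that is not a `(+,+)` c-layer. -/
theorem plateBall_source_mirror (hk : ¬ (σ (k - 1) = 1 ∧ σ k = 1)) {r : E3} (hr : r ∈ fccSlots) (hr2 : r 2 = 0) :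
    L (barlowPos 1 (Real.sqrt (2 / 3)) σ k i j) + s ∈ X ∧
    (∃ a ∈ fccSlots, ∃ a' ∈ fccSlots, ∃ a'' ∈ fccSlots,
      ⟪a, a'⟫_ℝ = 1 / 2 ∧ ⟪a, a''⟫_ℝ = 1 / 2 ∧ ⟪a', a''⟫_ℝ = 1 / 2 ∧
      L (barlowPos 1 (Real.sqrt (2 / 3)) σ k i j) + s + (basalMirror.trans L) a ∈ X ∧
      L (barlowPos 1 (Real.sqrt (2 / 3)) σ k i j) + s + (basalMirror.trans L) a' ∈ X ∧
      L (barlowPos 1 (Real.sqrt (2 / 3)) σ k i j) + s + (basalMirror.trans L) a'' ∈ X) ∧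
    L (barlowPos 1 (Real.sqrt (2 / 3)) σ k i j) + s - (basalMirror.trans L) r ∈ X ∧
    (IsFull X (basalMirror.trans L) (L (barlowPos 1 (Real.sqrt (2 / 3)) σ k i j) + s) ∨
      ∃ m, IsTwinReading X (basalMirror.trans L) m (L (barlowPos 1 (Real.sqrt (2 / 3)) σ k i j) + s) ∧
        ⟪(basalMirror.trans L) r, m⟫_ℝ = 0) := by
  have hmem := plateBall_mem L s hplate k i j hW
  have hbr : basalMirror r = r := by
    ext t
    rw [basalMirror_apply_coord]
    split_ifs with ht
    · rw [ht, hr2, neg_zero]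
    · rfl
  have hre₃ : ⟪(basalMirror.trans L) r, L (EuclideanSpace.single (2 : Fin 3) (1 : ℝ))⟫_ℝ = 0 := by
    rw [LinearIsometryEquiv.trans_apply, hbr, LinearIsometryEquiv.inner_map_map, inner_single_two_one, hr2]
  rcases (hσ (k - 1)) with h₁ | h₁ <;> rcases (hσ k) with h₂ | h₂
  · exact absurd ⟨h₁, h₂⟩ hk
  · -- (+,−): TWIN along `−L e₃` in the mirror frame
    have ht := isTwinReading_mirror_plateBall_up hσ L s hsep hplate k i j hW h₁ h₂
    have h0 : ⟪(basalMirror.trans L) r, -L (EuclideanSpace.single (2 : Fin 3) (1 : ℝ))⟫_ℝ = 0 := by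
      rw [inner_neg_right, hre₃, neg_zero]
    exact ⟨hmem, face_of_isTwinReading _ ht, sub_mem_of_isTwinReading_glide _ ht hr h0, Or.inr ⟨_, ht, h0⟩⟩
  · -- (−,+): TWIN along `L e₃` in the mirror frame
    have ht := isTwinReading_mirror_plateBall_down hσ L s hsep hplate k i j hW h₁ h₂
    exact ⟨hmem, face_of_isTwinReading _ ht, sub_mem_of_isTwinReading_glide _ ht hr hre₃, Or.inr ⟨_, ht, hre₃⟩⟩
  · -- (−,−): FULL in the mirror frame
    have hf := isFull_mirror_plateBall L s hsep hplate k i j hW h₁ h₂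
    exact ⟨hmem, face_of_isFull _ hf, sub_mem_of_isFull _ hf hr, Or.inl hf⟩

end Plate

/-! ### The clause `hPsrc` verbatim for a core `P'` -/

section Core

variable {σ : ℤ → ℤ} (hσ : IsHaggSeq σ) (L : E3 ≃ₗᵢ[ℝ] E3) (s : E3) {X : Finset E3}
  (hsep : ∀ p ∈ X, ∀ p' ∈ X, p ≠ p' → 1 ≤ dist p p') {W : Set E3}
  (hplate : ∀ p ∈ stacking L s σ, p ∈ W → p ∈ X)
  (ver : WordVersion) {F : List E3 → (E3 ≃ₗᵢ[ℝ] E3)} {r : E3} (hr : r ∈ fccSlots) (hr2 : r 2 = 0)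
  {P : E3 × List E3 → Prop} (P' : Finset E3) (srcOK : E3 → Prop)

include hσ hsep hplate hr hr2

open scoped Classical in
/-- **`hPsrc` for the plate frame** (`F [] = L`): admissible core balls are balls of layers `≠ (−,−)` deep in the clamped region,
carrying the invariant at their first target. -/
theorem hPsrc_of_plateCore_frame (hF0 : F [] = L)
    (hadm : ∀ p ∈ P', srcOK p → ∃ k i j : ℤ, p = L (barlowPos 1 (Real.sqrt (2 / 3)) σ k i j) + s ∧
      (∀ x, dist p x ≤ 2 → x ∈ W) ∧ ¬ (σ (k - 1) = -1 ∧ σ k = -1))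
    (hP : ∀ p ∈ P', srcOK p → P (p + F [] r, [])) :
    ∀ p ∈ P', srcOK p → p ∈ X ∧
      (∃ a ∈ fccSlots, ∃ a' ∈ fccSlots, ∃ a'' ∈ fccSlots,
        ⟪a, a'⟫_ℝ = 1 / 2 ∧ ⟪a, a''⟫_ℝ = 1 / 2 ∧ ⟪a', a''⟫_ℝ = 1 / 2 ∧
        p + F [] a ∈ X ∧ p + F [] a' ∈ X ∧ p + F [] a'' ∈ X) ∧
      p - F [] r ∈ X ∧
      (IsFull X (F []) p ∨ (∃ m, IsTwinReading X (F []) m p ∧ ⟪F [] r, m⟫_ℝ = 0) ∨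
        (ver = WordVersion.v2 ∧ IsNarrow X (F []) (F [] r) p)) ∧
      P (p + F [] r, []) := by
  intro p hp hok
  obtain ⟨k, i, j, rfl, hW, hk⟩ := hadm p hp hok
  obtain ⟨hmem, hface, hpred, hmv⟩ := plateBall_source_frame hσ L s hsep hplate k i j hW hk hr hr2
  rw [hF0]
  refine ⟨hmem, hface, hpred, ?_, ?_⟩
  · rcases hmv with h | h
    · exact Or.inl h
    · exact Or.inr (Or.inl h)
  · have := hP _ hp hok
    rwa [hF0] at this

open scoped Classical in
/-- **`hPsrc` for the mirror frame** (`F [] = basalMirror ≫ L`): admissible core balls are balls of layers `≠ (+,+)`. -/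
theorem hPsrc_of_plateCore_mirror (hF0 : F [] = basalMirror.trans L)
    (hadm : ∀ p ∈ P', srcOK p → ∃ k i j : ℤ, p = L (barlowPos 1 (Real.sqrt (2 / 3)) σ k i j) + s ∧
      (∀ x, dist p x ≤ 2 → x ∈ W) ∧ ¬ (σ (k - 1) = 1 ∧ σ k = 1))
    (hP : ∀ p ∈ P', srcOK p → P (p + F [] r, [])) :
    ∀ p ∈ P', srcOK p → p ∈ X ∧
      (∃ a ∈ fccSlots, ∃ a' ∈ fccSlots, ∃ a'' ∈ fccSlots,
        ⟪a, a'⟫_ℝ = 1 / 2 ∧ ⟪a, a''⟫_ℝ = 1 / 2 ∧ ⟪a', a''⟫_ℝ = 1 / 2 ∧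
        p + F [] a ∈ X ∧ p + F [] a' ∈ X ∧ p + F [] a'' ∈ X) ∧
      p - F [] r ∈ X ∧
      (IsFull X (F []) p ∨ (∃ m, IsTwinReading X (F []) m p ∧ ⟪F [] r, m⟫_ℝ = 0) ∨
        (ver = WordVersion.v2 ∧ IsNarrow X (F []) (F [] r) p)) ∧
      P (p + F [] r, []) := by
  intro p hp hok
  obtain ⟨k, i, j, rfl, hW, hk⟩ := hadm p hp hok
  obtain ⟨hmem, hface, hpred, hmv⟩ := plateBall_source_mirror hσ L s hsep hplate k i j hW hk hr hr2
  rw [hF0]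
  refine ⟨hmem, hface, hpred, ?_, ?_⟩
  · rcases hmv with h | h
    · exact Or.inl h
    · exact Or.inr (Or.inl h)
  · have := hP _ hp hok
    rwa [hF0] at this

end Core

end Summit.Ventures.Crystal3D.Theorems

end
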